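/- Width seat `ym-line-cbag-p1-w5` (prover-ym-line-cbag-p1-w5-g16-0; own items stmt-QuantumFields-22254 / 22893 CLOSED·proved) on the
LEAD's LINE 7b of route `GlueballBandRecursion`, item ⟨stmt-QuantumFields-22957⟩ — PIECE F of the LEAD's division of labour
(HOME STATUS 2026-08-28T20:11:33Z): the volume-uniform strong-coupling FLOOR `(c₁β⁴)^t ≤ x_t(N)` on the cold thermal trace excess for
ALL spatial sides `N ≥ N₀` (not only the odd sides `2S+1` of the IR cell) and for EVERY compact `G` with `Re tr r.ρ` non-constant
(not only compact simple Lie `G`).  Helper (`--supports stmt-QuantumFields-22957 --as helper`); it closes no item. -/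
import Summits.QuantumFields.YangMills.Theorems.IR.VolumeMonotoneTraceExcessFloor
import Summits.QuantumFields.YangMills.Theorems.GlueballBandRecursionThermalFreeEnergyDefs
import Summits.QuantumFields.YangMills.Theorems.GlueballBandRecursionRateToolkit
import HarnessLib

/-!
# Route `GlueballBandRecursion`, LINE 7b (volume comparison): the floor `(c₁β⁴)^{m+2} ≤ traceExcess r.ρ β N (m+2)` for ALL sides

Write `x_t(N) := traceExcess ρ β N t = Z_β(N³ × t)/λ₊(β,N)^t − 1 = Σ_{i ≠ i₀} (λᵢ/λ₊)^t ≥ 0` for the thermal trace excess of the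
spatial torus `(ℤ/N)³` at Euclidean period `t`, `r_ρ = strongCouplingRadius ρ` for module XII's Kotecký–Preiss window.  The IR cell
proved the volume-uniform floor on ODD tori for compact simple Lie `G`
(`Cruxes.IR.VolumeMonotone.traceExcess_floor_strongCoupling_uniform`: `∃ βF c₁ S₀, ∀ β ∈ (0, βF] ∀ S ≥ S₀ ∀ m, (c₁β⁴)^{m+2} ≤ x_{m+2}(2S+1)`).
LINE 7b's assembly `ThermalFreeEnergyVolumeJets → FloorAllSides → TraceExcessVolumeComparisonSmallCoupling → ColdDoublingRecursionSmallCoupling`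
(LEAD ym-line-cbag-p1 g29) compares the SAME cold time on the tori `L³` and `L'³`, `L' ∈ [2L, 4L]` — even sides included — and is
typed for every compact `G` / faithful `r`; this file supplies the floor in that generality:

* §1 `log_one_add_traceExcess_le_pow` — **the rate-tracking thermal bound with an explicit power of `β`**: for `0 < β ≤ r_ρ`, every
  side `N ≥ 1` and `2j ≤ T + 2`, `log(1 + x_{T+2}(N)) ≤ 144 N³ e^{−(T+2)/4} (β/r_ρ)^j` (module XII's chain at rate
  `τ = 1 + log(r_ρ/β)`, `Cruxes.IR.StrongCouplingRate.log_one_add_traceExcess_le_rate`, with the exponent split as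
  `e^{−τk} = e^{−k}·(β/r_ρ)^k`, `k = ⌊(T+2)/2⌋ ≥ j`);
* §1 `traceExcess_thermal_small_allSides` — **β⁴-smallness of the two thermal corrections with a β-FREE side threshold**: for every
  `η > 0` ONE `N₀` with `x_{T+2}(N) ≤ η·β⁴/r_ρ⁴` for all `0 < β ≤ r_ρ`, `N ≥ N₀`, `N ≤ T + 3` (`N³e^{−(N−1)/4} → 0`);
* §2 `traceExcess_floor_allSides_of_nonconst` ∕ `traceExcess_floor_allSides` — **THE FLOOR FOR ALL SIDES**: for every compact `G`
  (Borel σ-algebra) and `r : LatticeRep G` with `∃ g h, Re tr r.ρ g ≠ Re tr r.ρ h` there are `0 < βF ≤ r_ρ`, `c₁ > 0` and ONE `N₀` with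
  `(c₁β⁴)^{m+2} ≤ traceExcess r.ρ β N (m+2)` for ALL `0 ≤ β ≤ βF`, ALL sides `N ≥ N₀` and all `m` (`β = 0` is free: the floor is `0 ≤ x`);
  same proof as the IR cell's: the volume-uniform `β⁴` law for the facing-plaquette covariance on EVERY torus `(ℤ/N)⁴`, `N ≥ 3`
  (`SCFloor.facingPlaquetteCorr_floor`) + the spectral core step `VolumeMonotone.traceExcess_floor_of_facingCov` (any `N ≥ 3`) + §1 for
  the two thermal corrections `x_{m+2}(N)`, `N ≤ m + 3`, below `cβ⁴/(8p²)`, `p = max N_r 1`; `c₁ = c/(2p²)`, `βF = min β₀ r_ρ`;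
* §2 `Thermal.traceExcessFloorAllSides_holds : Thermal.TraceExcessFloorAllSides` — **the LEAD's typed floor statement of LINE 7b
  (`Theorems/GlueballBandRecursionThermalFreeEnergyDefs.lean`), PROVED** (it is the `0 < β` form without the `βF ≤ r_ρ` conjunct);
* §2 variants in the binders consumers use: `…_pos` (`0 < β`, verbatim the LEAD's typing), `…_of_nontrivial` (`Re tr r.ρ` is non-constant
  as soon as `G` has an element `≠ 1`, by faithfulness and `Re tr U = N ⇒ U = 1` for unitary `U`), `…_of_isCompactSimpleLieGroup`
  (the IR cell's binder, now for all sides).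

HONEST FRAMING.  Strong-coupling bookkeeping (a finite, volume-uniform lattice glueball mass `≤ 4 log(1/β) + O(1)` on every large
spatial torus, odd or even); an input of the `∃ β₁`-window RECORD-type rung `ColdDoublingRecursionSmallCoupling` of LINE 7b.  Nothing here
proves the volume comparison `TraceExcessVolumeComparison(SmallCoupling)`, item ⟨22957⟩ `OneParticleBlochSymbolFamily`, the rung
`Cruxes.IR.ColdPurityBridge.ColdDoublingRecursionStrongCoupling`, anything at weak coupling, or the Yang–Mills mass gap / the summit `YangMills`.
Refs: K. Osterwalder, E. Seiler, Ann. Phys. 110 (1978) 440 §3; I. Montvay, G. Münster (1994) §3.4; R. Kotecký, D. Preiss, CMP 103 (1986) 491.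
-/

set_option autoImplicit false

noncomputable section

open MeasureTheory Filter Topology
open Literature.Probability.LatticeModels
open Literature.MathematicalPhysics.QuantumFieldTheory
open Literature.MathematicalPhysics.QuantumLattice (plaquetteObs)
open Literature.MathematicalPhysics.QuantumFieldTheory.Balaban1983to89
open Literature.MathematicalPhysics.QuantumFieldTheory.Balaban1983to89.Missing
open Summit.QuantumFields.YangMills.Cruxes.IR.StrongCouplingRate (tube_error_le_rate log_one_add_traceExcess_le_rate)
open Summit.QuantumFields.YangMills.Cruxes.IR.VolumeMonotone (traceExcess_floor_of_facingCov)
open Summit.QuantumFields.YangMills.Cruxes.IR (SCFloor.facingPlaquetteCorr_floor SCFloor.latticeConnectedCorr_plaquette_one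
  SCFloor.latticeRep_re_trace_nonconst)

namespace Summit.QuantumFields.YangMills.Theorems.GlueballBandRecursion.FloorAllSides

/-! ## §0 Scalar bookkeeping -/

/-- `log(1 + x) ≤ B ≤ 1` with `x ≥ 0` forces `x ≤ 2B` (`e^B − 1 ≤ 2B` on `[0, 1]`). -/
theorem le_two_mul_of_log_one_add_le {x B : ℝ} (hx : 0 ≤ x) (hB : Real.log (1 + x) ≤ B) (hB1 : B ≤ 1) :
    x ≤ 2 * B := by
  have h1x : 0 < 1 + x := by linarith
  have hB0 : 0 ≤ B := le_trans (Real.log_nonneg (by linarith)) hB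
  have hexp : 1 + x ≤ Real.exp B := by
    calc 1 + x = Real.exp (Real.log (1 + x)) := (Real.exp_log h1x).symm
      _ ≤ Real.exp B := Real.exp_le_exp.2 hB
  have habs : |B| ≤ 1 := by rw [abs_of_nonneg hB0]; exact hB1
  have h2 := Real.abs_exp_sub_one_le habs
  rw [abs_of_nonneg hB0] at h2
  have h3 : Real.exp B - 1 ≤ 2 * B := le_trans (le_abs_self _) h2
  linarith

/-- **The β-free side threshold**: for `A, η > 0` there is `N₀ ≥ 9` with `A · N³ · e^{−(N−1)/4} ≤ η` for every `N ≥ N₀`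
(`u³e^{−u} → 0`, `u = N/4`). -/
theorem exists_sides_threshold {A η : ℝ} (hA : 0 < A) (hη : 0 < η) :
    ∃ N₀ : ℕ, 9 ≤ N₀ ∧ ∀ N : ℕ, N₀ ≤ N → A * (N : ℝ) ^ 3 * Real.exp (-(1 / 4 * ((N : ℝ) - 1))) ≤ η := by
  have ht : Tendsto (fun u : ℝ => u ^ 3 * Real.exp (-u)) atTop (𝓝 0) :=
    Real.tendsto_pow_mul_exp_neg_atTop_nhds_zero 3
  set κ : ℝ := η / (A * 64 * Real.exp (1 / 4)) with hκ
  have hκpos : 0 < κ := by positivity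
  obtain ⟨X, hX⟩ := eventually_atTop.1 ((tendsto_order.1 ht).2 κ hκpos)
  refine ⟨max 9 ⌈4 * X⌉₊, le_max_left _ _, fun N hN => ?_⟩
  set u : ℝ := (N : ℝ) / 4 with hu
  have huX : X ≤ u := by
    have h1 : (4 * X : ℝ) ≤ ⌈4 * X⌉₊ := Nat.le_ceil _
    have h2 : ((⌈4 * X⌉₊ : ℕ) : ℝ) ≤ N := by exact_mod_cast (le_max_right _ _).trans hN
    rw [hu]; linarith
  have h3 : u ^ 3 * Real.exp (-u) < κ := hX u huX
  have hN3 : (N : ℝ) ^ 3 = 64 * u ^ 3 := by rw [hu]; ring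
  have hexp : Real.exp (-(1 / 4 * ((N : ℝ) - 1))) = Real.exp (1 / 4) * Real.exp (-u) := by
    rw [← Real.exp_add]; congr 1; rw [hu]; ring
  calc A * (N : ℝ) ^ 3 * Real.exp (-(1 / 4 * ((N : ℝ) - 1)))
      = A * 64 * Real.exp (1 / 4) * (u ^ 3 * Real.exp (-u)) := by rw [hN3, hexp]; ring
    _ ≤ A * 64 * Real.exp (1 / 4) * κ := mul_le_mul_of_nonneg_left h3.le (by positivity)
    _ = η := by rw [hκ]; field_simp

/-! ## §1 The thermal trace excess at rate `1 + log(r_ρ/β)`: an explicit power of `β`, every side -/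

section Thermal

variable {G : Type} [Group G] [TopologicalSpace G] [IsTopologicalGroup G] [CompactSpace G]
  [MeasurableSpace G] [BorelSpace G] [SecondCountableTopology G] {n : ℕ} (ρ : G →* Matrix (Fin n) (Fin n) ℂ)

/-- **Rate-tracking thermal bound with an explicit power of `β`.**  For continuous unitary `ρ`, `0 < β ≤ r_ρ = strongCouplingRadius ρ`,
every spatial side `N ≥ 1`, every Euclidean period `T + 2` and every `j` with `2j ≤ T + 2`:
`log(1 + traceExcess ρ β N (T+2)) ≤ 144 · N³ · e^{−(T+2)/4} · (β/r_ρ)^j`.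
Module XII's chain at the rate `τ = 1 + log(r_ρ/β)` (`log_one_add_traceExcess_le_rate`: `≤ 12N³(T+2)e^{−τ⌊(T+2)/2⌋}`), the exponent
split as `e^{−τk} = e^{−k}·(β/r_ρ)^k ≤ e^{−k}·(β/r_ρ)^j` (`k = ⌊(T+2)/2⌋ ≥ j`, `β ≤ r_ρ`) and `12(T+2)e^{−k} ≤ 144e^{−(T+2)/4}`
(`tube_error_le_rate` at rate `1`). -/
theorem log_one_add_traceExcess_le_pow (hρ : Continuous ρ) (hρu : ∀ g, ρ g ∈ Matrix.unitaryGroup (Fin n) ℂ)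
    {β : ℝ} (hβ0 : 0 < β) (hβ : β ≤ strongCouplingRadius ρ) (N T j : ℕ) [NeZero N] (hj : 2 * j ≤ T + 2) :
    Real.log (1 + traceExcess ρ β N (T + 2)) ≤
      144 * (N : ℝ) ^ 3 * Real.exp (-(1 / 4 * ((T : ℝ) + 2))) * (β ^ j / strongCouplingRadius ρ ^ j) := by
  have hr0 := strongCouplingRadius_pos ρ
  have hM := costBound_pos ρ
  have hq : 1 ≤ strongCouplingRadius ρ / β := by rw [le_div_iff₀ hβ0, one_mul]; exact hβ
  have hL0 : 0 ≤ Real.log (strongCouplingRadius ρ / β) := Real.log_nonneg hq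
  have hτ : 1 ≤ 1 + Real.log (strongCouplingRadius ρ / β) := by linarith
  have hβM : β * costBound ρ ≤ 1 :=
    le_trans (mul_le_mul_of_nonneg_right hβ hM.le) (strongCouplingRadius_mul_costBound_le_one ρ)
  have hexp2 : Real.exp (1 + (1 + Real.log (strongCouplingRadius ρ / β))) =
      Real.exp 2 * (strongCouplingRadius ρ / β) := by
    rw [show (1 : ℝ) + (1 + Real.log (strongCouplingRadius ρ / β)) = 2 + Real.log (strongCouplingRadius ρ / β) by ring,
      Real.exp_add, Real.exp_log (lt_of_lt_of_le one_pos hq)]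
  have hsmall : Real.exp (1 + (1 + Real.log (strongCouplingRadius ρ / β))) * (2 * costBound ρ * β) *
      ((boxDeg 4 : ℝ) + 1) ^ 2 ≤ 1 / 2 := by
    rw [hexp2]
    have heq : Real.exp 2 * (strongCouplingRadius ρ / β) * (2 * costBound ρ * β) =
        Real.exp 2 * (2 * costBound ρ * strongCouplingRadius ρ) := by
      field_simp
    rw [heq]
    exact strongCouplingRadius_smallness ρ
  have h := log_one_add_traceExcess_le_rate ρ hρ hρu hβ0.le hτ hβM hsmall N T
  refine h.trans ?_
  -- split the exponent: `e^{−(1+L)k} = e^{−k} · e^{−Lk}`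
  have hsplit : Real.exp (-((1 + Real.log (strongCouplingRadius ρ / β)) * ((((T + 2) / 2 : ℕ) : ℝ)))) =
      Real.exp (-(1 * ((((T + 2) / 2 : ℕ) : ℝ)))) *
        Real.exp (-(Real.log (strongCouplingRadius ρ / β) * ((((T + 2) / 2 : ℕ) : ℝ)))) := by
    rw [← Real.exp_add]; congr 1; ring
  -- `e^{−Lk} ≤ e^{−Lj} = (β/r_ρ)^j`
  have hjk : (j : ℝ) ≤ ((((T + 2) / 2 : ℕ) : ℝ)) := by
    have : j ≤ (T + 2) / 2 := by omega
    exact_mod_cast this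
  have hLk : Real.exp (-(Real.log (strongCouplingRadius ρ / β) * ((((T + 2) / 2 : ℕ) : ℝ)))) ≤
      β ^ j / strongCouplingRadius ρ ^ j := by
    have h1 : Real.exp (-(Real.log (strongCouplingRadius ρ / β) * ((((T + 2) / 2 : ℕ) : ℝ)))) ≤
        Real.exp (-(Real.log (strongCouplingRadius ρ / β) * (j : ℝ))) := by
      refine Real.exp_le_exp.2 ?_
      have := mul_le_mul_of_nonneg_left hjk hL0
      linarith
    refine h1.trans (le_of_eq ?_)
    have hlog : Real.log (β / strongCouplingRadius ρ) = -Real.log (strongCouplingRadius ρ / β) := by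
      rw [← inv_div (strongCouplingRadius ρ) β, Real.log_inv]
    rw [show -(Real.log (strongCouplingRadius ρ / β) * (j : ℝ)) = (j : ℝ) * Real.log (β / strongCouplingRadius ρ) by
        rw [hlog]; ring,
      Real.exp_nat_mul, Real.exp_log (div_pos hβ0 hr0), div_pow]
  -- `12 N³ (T+2) e^{−k} ≤ 144 N³ e^{−(T+2)/4}`
  have htube := tube_error_le_rate N (t := T + 2) (by omega) (τ := 1) le_rfl
  push_cast at htube
  have hA0 : 0 ≤ 12 * (N : ℝ) ^ 3 * ((T : ℝ) + 2) * Real.exp (-(1 * ((((T + 2) / 2 : ℕ) : ℝ)))) := by positivity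
  have hq0 : 0 ≤ β ^ j / strongCouplingRadius ρ ^ j := by positivity
  calc 12 * (N : ℝ) ^ 3 * ((T : ℝ) + 2) *
        Real.exp (-((1 + Real.log (strongCouplingRadius ρ / β)) * ((((T + 2) / 2 : ℕ) : ℝ))))
      = 12 * (N : ℝ) ^ 3 * ((T : ℝ) + 2) * Real.exp (-(1 * ((((T + 2) / 2 : ℕ) : ℝ)))) *
          Real.exp (-(Real.log (strongCouplingRadius ρ / β) * ((((T + 2) / 2 : ℕ) : ℝ)))) := by
        rw [hsplit]; ring
    _ ≤ 144 * (N : ℝ) ^ 3 * Real.exp (-(1 / 4 * ((T : ℝ) + 2))) * (β ^ j / strongCouplingRadius ρ ^ j) :=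
        mul_le_mul htube hLk (Real.exp_pos _).le (by positivity)

/-- **β⁴-smallness of the cold thermal corrections with a β-FREE side threshold.**  For continuous unitary `ρ` and every `η > 0` there is
ONE `N₀ ≥ 9` such that for all `0 < β ≤ r_ρ`, every spatial side `N ≥ N₀` and every period `T + 2 ≥ N − 1`:
`traceExcess ρ β N (T+2) ≤ η · β⁴/r_ρ⁴`.  (§1's bound with `j = 4`, `e^{−(T+2)/4} ≤ e^{−(N−1)/4}`, `288·N³e^{−(N−1)/4} ≤ min η 2` for
`N ≥ N₀` by `exists_sides_threshold`, and `log(1+x) ≤ B ≤ 1 ⇒ x ≤ 2B`.)  This is the all-sides form of the IR cell's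
`VolumeMonotone.traceExcess_thermal_le_pow_four` (there: odd sides `2S+1`, `S ≥ 16`). -/
theorem traceExcess_thermal_small_allSides (hρ : Continuous ρ) (hρu : ∀ g, ρ g ∈ Matrix.unitaryGroup (Fin n) ℂ)
    {η : ℝ} (hη : 0 < η) :
    ∃ N₀ : ℕ, 9 ≤ N₀ ∧ ∀ β : ℝ, 0 < β → β ≤ strongCouplingRadius ρ →
      ∀ (N : ℕ) [NeZero N], N₀ ≤ N → ∀ T : ℕ, N ≤ T + 3 →
        traceExcess ρ β N (T + 2) ≤ η * (β ^ 4 / strongCouplingRadius ρ ^ 4) := by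
  obtain ⟨N₀, hN₀9, hN₀⟩ := exists_sides_threshold (A := 288) (by norm_num) (lt_min hη two_pos)
  refine ⟨N₀, hN₀9, fun β hβ0 hβ N _ hN T hT => ?_⟩
  have hr0 := strongCouplingRadius_pos ρ
  have hq1 : β ^ 4 / strongCouplingRadius ρ ^ 4 ≤ 1 := by
    rw [div_le_one (by positivity)]
    exact pow_le_pow_left₀ hβ0.le hβ 4
  have hq0 : 0 ≤ β ^ 4 / strongCouplingRadius ρ ^ 4 := by positivity
  have hlog := log_one_add_traceExcess_le_pow ρ hρ hρu hβ0 hβ N T 4 (by omega)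
  have hTN : Real.exp (-(1 / 4 * ((T : ℝ) + 2))) ≤ Real.exp (-(1 / 4 * ((N : ℝ) - 1))) := by
    refine Real.exp_le_exp.2 ?_
    have : (N : ℝ) ≤ (T : ℝ) + 3 := by exact_mod_cast hT
    linarith
  have hthr := hN₀ N hN
  have hB2 : 2 * (144 * (N : ℝ) ^ 3 * Real.exp (-(1 / 4 * ((T : ℝ) + 2))) * (β ^ 4 / strongCouplingRadius ρ ^ 4)) ≤
      min η 2 * (β ^ 4 / strongCouplingRadius ρ ^ 4) := by
    have h1 : 2 * (144 * (N : ℝ) ^ 3 * Real.exp (-(1 / 4 * ((T : ℝ) + 2))) * (β ^ 4 / strongCouplingRadius ρ ^ 4)) =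
        288 * (N : ℝ) ^ 3 * Real.exp (-(1 / 4 * ((T : ℝ) + 2))) * (β ^ 4 / strongCouplingRadius ρ ^ 4) := by ring
    rw [h1]
    have h2 : 288 * (N : ℝ) ^ 3 * Real.exp (-(1 / 4 * ((T : ℝ) + 2))) ≤
        288 * (N : ℝ) ^ 3 * Real.exp (-(1 / 4 * ((N : ℝ) - 1))) := mul_le_mul_of_nonneg_left hTN (by positivity)
    exact mul_le_mul_of_nonneg_right (h2.trans hthr) hq0
  have hB1 : 144 * (N : ℝ) ^ 3 * Real.exp (-(1 / 4 * ((T : ℝ) + 2))) * (β ^ 4 / strongCouplingRadius ρ ^ 4) ≤ 1 := by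
    have h3 : min η 2 * (β ^ 4 / strongCouplingRadius ρ ^ 4) ≤ 2 * 1 :=
      mul_le_mul (min_le_right _ _) hq1 hq0 zero_le_two
    linarith
  have hx0 : 0 ≤ traceExcess ρ β N (T + 2) := Rate.traceExcess_nonneg hρ hρu hβ0.le N T
  have hx := le_two_mul_of_log_one_add_le hx0 hlog hB1
  have h4 : min η 2 * (β ^ 4 / strongCouplingRadius ρ ^ 4) ≤ η * (β ^ 4 / strongCouplingRadius ρ ^ 4) :=
    mul_le_mul_of_nonneg_right (min_le_left _ _) hq0
  linarith

end Thermal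

/-! ## §2 The floor `(c₁β⁴)^{m+2} ≤ traceExcess r.ρ β N (m+2)` for ALL sides `N ≥ N₀` -/

section Floor

variable {G : Type} [Group G] [TopologicalSpace G] [IsTopologicalGroup G] [CompactSpace G]
  [MeasurableSpace G] [BorelSpace G]

/-- For a faithful unitary representation `r` of a group with an element `a ≠ 1`, `Re tr r.ρ` is not constant:
`r.ρ a ≠ 1 = r.ρ 1` by faithfulness and a unitary `U ≠ 1` has `Re tr U ≠ N = Re tr 1` (Horn–Johnson 7.4.1.4, tree
`Literature.LinearAlgebra.Matrix.re_trace_eq_card_iff_of_mem_unitaryGroup`).  Variant of `SCFloor.latticeRep_re_trace_nonconst`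
(there from a non-commuting pair). -/
theorem latticeRep_re_trace_nonconst_of_ne_one {G : Type} [Group G] [TopologicalSpace G] {a : G} (ha : a ≠ 1)
    (r : LatticeRep G) : ∃ g h : G, (r.ρ g).trace.re ≠ (r.ρ h).trace.re := by
  refine ⟨a, 1, fun h => ha (r.injective ?_)⟩
  rw [map_one]
  have hN : ((r.ρ 1).trace).re = (Fintype.card (Fin r.N) : ℝ) := by
    rw [map_one, Matrix.trace_one, Fintype.card_fin]
    simp
  rw [hN] at h
  have h' : RCLike.re (Matrix.trace (r.ρ a)) = Fintype.card (Fin r.N) := by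
    simpa using h
  exact (Literature.LinearAlgebra.Matrix.re_trace_eq_card_iff_of_mem_unitaryGroup (r.mem_unitary a)).1 h'

/-- **THE FLOOR FOR ALL SIDES (ambient-instance form).**  For a compact group `G` with a Borel structure and `r : LatticeRep G` with
`Re tr r.ρ` non-constant there are `0 < βF ≤ strongCouplingRadius r.ρ`, `c₁ > 0` and ONE side threshold `N₀` such that
`(c₁β⁴)^{m+2} ≤ traceExcess r.ρ β N (m+2)` for ALL `0 ≤ β ≤ βF`, ALL spatial sides `N ≥ N₀` and all `m`.
Constants: `βF = min β₀ r_ρ` and `c₁ = c/(2p²)` from the `β⁴` law `cβ⁴ ≤ Cov(P₀,P₁)` of `SCFloor.facingPlaquetteCorr_floor` (`p = max N_r 1`),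
`N₀` from `traceExcess_thermal_small_allSides` at `η = c r_ρ⁴/(8p²)`; the core step is `VolumeMonotone.traceExcess_floor_of_facingCov`. -/
theorem traceExcess_floor_allSides_of_nonconst (r : LatticeRep G)
    (hnc : ∃ g h : G, (r.ρ g).trace.re ≠ (r.ρ h).trace.re) :
    ∃ βF c₁ : ℝ, ∃ N₀ : ℕ, 0 < βF ∧ βF ≤ strongCouplingRadius r.ρ ∧ 0 < c₁ ∧
      ∀ β : ℝ, 0 ≤ β → β ≤ βF → ∀ (N : ℕ) [NeZero N], N₀ ≤ N → ∀ m : ℕ,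
        (c₁ * β ^ 4) ^ (m + 2) ≤ traceExcess r.ρ β N (m + 2) := by
  have hemb : IsClosedEmbedding r.ρ := r.continuous.isClosedEmbedding r.injective
  haveI : T2Space G := hemb.isEmbedding.t2Space
  haveI : SecondCountableTopology G := hemb.isEmbedding.secondCountableTopology
  obtain ⟨β₀, c, C, hβ₀, hc, -, hfloor⟩ := SCFloor.facingPlaquetteCorr_floor r.ρ r.continuous hnc
  have hr0 := strongCouplingRadius_pos r.ρ
  set p : ℝ := max (r.N : ℝ) 1 with hpdef
  have hp : 0 < p := lt_of_lt_of_le one_pos (le_max_right _ _)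
  obtain ⟨N₀, hN₀9, hsmallN⟩ := traceExcess_thermal_small_allSides r.ρ r.continuous r.mem_unitary
    (show 0 < c * strongCouplingRadius r.ρ ^ 4 / (8 * p ^ 2) by positivity)
  refine ⟨min β₀ (strongCouplingRadius r.ρ), c / (2 * p ^ 2), N₀, lt_min hβ₀ hr0, min_le_right _ _, by positivity, ?_⟩
  intro β hβ0 hβF N _ hN m
  rcases hβ0.eq_or_lt with hβz | hβpos
  · -- `β = 0`: the floor is `0 ≤ x`
    rw [← hβz, zero_pow (by norm_num), mul_zero, zero_pow (by omega)]
    exact Rate.traceExcess_nonneg r.continuous r.mem_unitary le_rfl N m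
  have hββ₀ : β ≤ β₀ := hβF.trans (min_le_left _ _)
  have hβr : β ≤ strongCouplingRadius r.ρ := hβF.trans (min_le_right _ _)
  have hN3 : 3 ≤ N := le_trans (by omega) (hN₀9.trans hN)
  -- the floor on the facing-plaquette covariance of the torus `(ℤ/N)⁴`
  have hcovL := (hfloor N hN3 β hβpos hββ₀).1
  rw [SCFloor.latticeConnectedCorr_plaquette_one r.ρ N β] at hcovL
  -- the two thermal corrections, β⁴-small uniformly in the side `N ≥ N₀`
  have hx : ∀ m' : ℕ, N ≤ m' + 3 → traceExcess r.ρ β N (m' + 2) ≤ c * β ^ 4 / (8 * p ^ 2) := by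
    intro m' hm'
    refine (hsmallN β hβpos hβr N hN m' hm').trans (le_of_eq ?_)
    field_simp
  have hbudget : 8 * (max (r.N : ℝ) 1) ^ 2 * (c * β ^ 4 / (8 * p ^ 2)) ≤ c * β ^ 4 := by
    rw [← hpdef]
    have : 8 * p ^ 2 * (c * β ^ 4 / (8 * p ^ 2)) = c * β ^ 4 := by field_simp
    rw [this]
  have hmain := traceExcess_floor_of_facingCov r hβpos.le N hN3 hcovL hx hbudget m
  rw [← hpdef] at hmain
  have he : c / (2 * p ^ 2) * β ^ 4 = c * β ^ 4 / (2 * p ^ 2) := by ring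
  rw [he]
  exact hmain

/-- **THE FLOOR FOR ALL SIDES in the binder shape of LINE 7b** (`∀ G …, letI := borel G; ∀ r : LatticeRep G, (∃ g h, Re tr r.ρ g ≠ Re tr r.ρ h) → …`):
`∃ βF c₁ N₀, 0 < βF ≤ strongCouplingRadius r.ρ ∧ 0 < c₁ ∧ ∀ β ∈ [0, βF], ∀ N ≥ N₀, ∀ m, (c₁β⁴)^{m+2} ≤ traceExcess r.ρ β N (m+2)` —
the volume-uniform strong-coupling floor of the IR cell (`Cruxes.IR.VolumeMonotone.traceExcess_floor_strongCoupling_uniform`: compact simple Lie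
`G`, odd sides `2S+1`, `0 < β`) for EVERY compact `G` with `Re tr r.ρ` non-constant, EVERY side `N ≥ N₀`, and `β = 0` included. -/
theorem traceExcess_floor_allSides :
    ∀ (G : Type) [Group G] [TopologicalSpace G] [IsTopologicalGroup G] [CompactSpace G],
      letI : MeasurableSpace G := borel G; haveI : BorelSpace G := ⟨rfl⟩;
      ∀ (r : LatticeRep G), (∃ g h : G, (r.ρ g).trace.re ≠ (r.ρ h).trace.re) →
        ∃ βF c₁ : ℝ, ∃ N₀ : ℕ, 0 < βF ∧ βF ≤ strongCouplingRadius r.ρ ∧ 0 < c₁ ∧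
          ∀ β : ℝ, 0 ≤ β → β ≤ βF → ∀ (N : ℕ) [NeZero N], N₀ ≤ N → ∀ m : ℕ,
            (c₁ * β ^ 4) ^ (m + 2) ≤ traceExcess r.ρ β N (m + 2) := by
  intro G _ _ _ _
  letI : MeasurableSpace G := borel G
  haveI : BorelSpace G := ⟨rfl⟩
  intro r hnc
  exact traceExcess_floor_allSides_of_nonconst r hnc

/-- **The floor for all sides, `0 < β` form** — verbatim the LEAD's typing of PIECE F (HOME STATUS 2026-08-28T20:11:33Z):
`∃ βF c₁ N₀, 0 < βF ≤ r_ρ, 0 < c₁, ∀ β ∈ (0, βF], ∀ N ≥ N₀, ∀ m, (c₁β⁴)^{m+2} ≤ traceExcess r.ρ β N (m+2)`. -/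
theorem traceExcess_floor_allSides_pos :
    ∀ (G : Type) [Group G] [TopologicalSpace G] [IsTopologicalGroup G] [CompactSpace G],
      letI : MeasurableSpace G := borel G; haveI : BorelSpace G := ⟨rfl⟩;
      ∀ (r : LatticeRep G), (∃ g h : G, (r.ρ g).trace.re ≠ (r.ρ h).trace.re) →
        ∃ βF c₁ : ℝ, ∃ N₀ : ℕ, 0 < βF ∧ βF ≤ strongCouplingRadius r.ρ ∧ 0 < c₁ ∧
          ∀ β : ℝ, 0 < β → β ≤ βF → ∀ (N : ℕ) [NeZero N], N₀ ≤ N → ∀ m : ℕ,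
            (c₁ * β ^ 4) ^ (m + 2) ≤ traceExcess r.ρ β N (m + 2) := by
  intro G _ _ _ _
  letI : MeasurableSpace G := borel G
  haveI : BorelSpace G := ⟨rfl⟩
  intro r hnc
  obtain ⟨βF, c₁, N₀, hβF, hβFr, hc₁, h⟩ := traceExcess_floor_allSides_of_nonconst r hnc
  exact ⟨βF, c₁, N₀, hβF, hβFr, hc₁, fun β hβ hβF' N _ hN m => h β hβ.le hβF' N hN m⟩

/-- **The floor for all sides for every NON-TRIVIAL compact `G`** (the hypothesis `Re tr r.ρ` non-constant is automatic for a faithful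
`r` as soon as `G` has an element `≠ 1`, `latticeRep_re_trace_nonconst_of_ne_one`): `∃ βF c₁ N₀, 0 < βF ≤ r_ρ ∧ 0 < c₁ ∧ ∀ β ∈ [0, βF],
∀ N ≥ N₀, ∀ m, (c₁β⁴)^{m+2} ≤ traceExcess r.ρ β N (m+2)`.  (For the trivial group the floor is false: `x ≡ 0`.) -/
theorem traceExcess_floor_allSides_of_nontrivial :
    ∀ (G : Type) [Group G] [TopologicalSpace G] [IsTopologicalGroup G] [CompactSpace G] [Nontrivial G],
      letI : MeasurableSpace G := borel G; haveI : BorelSpace G := ⟨rfl⟩;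
      ∀ (r : LatticeRep G), ∃ βF c₁ : ℝ, ∃ N₀ : ℕ, 0 < βF ∧ βF ≤ strongCouplingRadius r.ρ ∧ 0 < c₁ ∧
        ∀ β : ℝ, 0 ≤ β → β ≤ βF → ∀ (N : ℕ) [NeZero N], N₀ ≤ N → ∀ m : ℕ,
          (c₁ * β ^ 4) ^ (m + 2) ≤ traceExcess r.ρ β N (m + 2) := by
  intro G _ _ _ _ _
  letI : MeasurableSpace G := borel G
  haveI : BorelSpace G := ⟨rfl⟩
  intro r
  obtain ⟨a, ha⟩ := exists_ne (1 : G)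
  exact traceExcess_floor_allSides_of_nonconst r (latticeRep_re_trace_nonconst_of_ne_one ha r)

/-- **The floor for all sides in the IR cell's binder** (`IsCompactSimpleLieGroup G →`, as in
`Cruxes.IR.VolumeMonotone.traceExcess_floor_strongCoupling_uniform`, now for EVERY side `N ≥ N₀`, odd or even, and `0 ≤ β`). -/
theorem traceExcess_floor_allSides_of_isCompactSimpleLieGroup :
    ∀ (G : Type) [Group G] [TopologicalSpace G] [IsTopologicalGroup G] [CompactSpace G],
      IsCompactSimpleLieGroup G →
      letI : MeasurableSpace G := borel G; haveI : BorelSpace G := ⟨rfl⟩;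
      ∀ (r : LatticeRep G), ∃ βF c₁ : ℝ, ∃ N₀ : ℕ, 0 < βF ∧ βF ≤ strongCouplingRadius r.ρ ∧ 0 < c₁ ∧
        ∀ β : ℝ, 0 ≤ β → β ≤ βF → ∀ (N : ℕ) [NeZero N], N₀ ≤ N → ∀ m : ℕ,
          (c₁ * β ^ 4) ^ (m + 2) ≤ traceExcess r.ρ β N (m + 2) := by
  intro G _ _ _ _ hG
  letI : MeasurableSpace G := borel G
  haveI : BorelSpace G := ⟨rfl⟩
  intro r
  exact traceExcess_floor_allSides_of_nonconst r (SCFloor.latticeRep_re_trace_nonconst hG.1.2.1 r)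

end Floor

end Summit.QuantumFields.YangMills.Theorems.GlueballBandRecursion.FloorAllSides

namespace Summit.QuantumFields.YangMills.Theorems.GlueballBandRecursion.Thermal

/-- **LINE 7b's floor statement `TraceExcessFloorAllSides`, PROVED** (the `def` of `Theorems/GlueballBandRecursionThermalFreeEnergyDefs.lean`,
LEAD ym-line-cbag-p1 g29): for every compact `G` (Borel σ-algebra) and `r : LatticeRep G` with `∃ g h, Re tr r.ρ g ≠ Re tr r.ρ h` there are
`βF > 0`, `c₁ > 0` and ONE side threshold `N₀` with `(c₁β⁴)^{m+2} ≤ traceExcess r.ρ β N (m+2)` for all `0 < β ≤ βF`, all sides `N ≥ N₀`,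
all `m`.  From `FloorAllSides.traceExcess_floor_allSides_of_nonconst` (which moreover gives `βF ≤ strongCouplingRadius r.ρ` and `β = 0`). -/
theorem traceExcessFloorAllSides_holds : TraceExcessFloorAllSides := by
  intro G _ _ _ _
  letI : MeasurableSpace G := borel G
  haveI : BorelSpace G := ⟨rfl⟩
  intro r hnc
  obtain ⟨βF, c₁, N₀, hβF, -, hc₁, h⟩ := FloorAllSides.traceExcess_floor_allSides_of_nonconst r hnc
  exact ⟨βF, c₁, N₀, hβF, hc₁, fun β hβ hβF' N _ hN m => h β hβ.le hβF' N hN m⟩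

end Summit.QuantumFields.YangMills.Theorems.GlueballBandRecursion.Thermal

end
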